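import Literature.NumberTheory.Automorphic.UnitaryGroupTorusOrbitalIntegralSelberg     -- ★ (this seat) E2-3b generic: the Selberg principle at a regular split-torus class, frame `e`
import Literature.NumberTheory.Rogawski1990.U3SupercuspFormUnipotentIntegralCM           -- ★ p852804 (F0P3a-p02 (g26)) E2-3a @ `Gqs`: `integral_dual_apply_cmBorelTriple_N_eq_zero_of_isSupercuspidal`
import Literature.NumberTheory.Automorphic.AdmissibleInvariantFormSchur                  -- ★ p852781 (F0P3a-p06 (g24)) E2-1 A: `IsSupercuspidal.hasCompactSupport_matrixCoeff`
import Literature.NumberTheory.Automorphic.ArchU21SplitIwasawa                           -- ★ `isMulRightInvariant_of_isHaarMeasure_unipotentU` (`N₃` unimodular)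
import Literature.NumberTheory.Automorphic.HeisenbergChartAtNonsplitPlace                -- ★ `isUnit_two_localRing`
import Literature.NumberTheory.Automorphic.UnitaryGroupFormCongrFinSum                   -- ★ `formCongr_one_eq` (identity frame)
import HarnessLib

/-!
# Orbital integrals of supercuspidal matrix coefficients of `U(Φ₃)(L⁺_v)` vanish at the regular hyperbolic classes
(Harish-Chandra (1970), Part VIII §1 Lemma 45 «Selberg principle» pp. 92–93, Part I §3 p. 9; Rogawski (1990), §12.5 p. 182, §12.6 p. 187)

Topic `NumberTheory/Rogawski1990`; namespace `Literature.NumberTheory.Rogawski1990`.  KERNEL mathematics only: one theorem, no definition, no named fact,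
no instance, no notation, no `sorry`.  Cell `pub/hodgecm-mathlib`, crux H413 = `stmt-HodgeConjecture-24833` (`--supports` lane), CENSUS «HC-SC» v1 §2 brick E2-3b,
the E2 dealer's WANTS-E2-5 v1 (S4-shape): the hyperbolic (`regG ∖ ellG`) clause of the supercuspidal pseudo-coefficient, `Gqs`-native, identity frame,
general smooth coefficient.  HONEST LABEL: count-neutral; HC_CM is proved only modulo the 7 printed citations (2 remaining named inputs: hLiu418 =
stmt-HodgeConjecture-24832, h413 = stmt-HodgeConjecture-24833) until rung 0 closes; this file discharges no named fact.

THE MATHEMATICS.  `G = U(Φ₃)(L⁺_v) = (cmDatum L 3 Φ₃).Local v` (`= Gqs L v`), `v` NON-SPLIT (so the centre `E¹_v` is compact).  Let `r` be an irreducible smooth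
representation of `G` whose class is supercuspidal, `ψ ∈ Ṽ` a smooth linear form and `y ∈ V`; the coefficient `u(g) = ψ(r(g) y)` is locally constant (★
`continuous_matrixCoeff`), compactly supported ON `G` (★ E2-1 A `IsSupercuspidal.hasCompactSupport_matrixCoeff`, compact centre), and a SUPERCUSP FORM:
`∫_N u(a n b) dn = 0` for all `a, b` (★ p852804).  Hence, by the Selberg principle at a regular split-torus class (★
`classOrbitalIntegral_torus_eq_zero_of_cuspidal'` in the IDENTITY frame `e₁ = cmDatumLocalCongr L v 1 _ _`, `e₁ u = u` by ★ `formCongr_one_eq`, with `K := K₃`,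
`κ`, `μ_N` Haar — `μ_N` right invariant because `N` is unimodular, ★ `isMulRightInvariant_of_isHaarMeasure_unipotentU`), for every CANONICAL orbital family `mG`
and every `γ` conjugate to a regular diagonal `t`: **`classOrbitalIntegral mG (g ↦ ψ(r(g) y)) ⟦γ⟧ = 0`**.  Consumer shape (E2-5 `scPseudoCoeff`): `γ ∈ hyperbolicSet L v`
unfolds to `∃ t, IsRegularElt t ∧ IsConj t γ`; regular ⇒ unit differences (★ `isUnit_sub_of_isRegularElt_glDiagonal`); `hZ` = ★ `isCompact_center_Gqs L v hns`.

## References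
* [HarishChandra1970] Harish-Chandra (notes by G. van Dijk), *Harmonic Analysis on Reductive p-adic Groups*, LNM 162 (1970), Part I §3 p. 9 (supercusp
  forms; matrix coefficients of supercuspidal representations), Part VIII §1 Lemma 45 «Selberg principle» pp. 92–93.
* [Rogawski1990] J. D. Rogawski, *Automorphic Representations of Unitary Groups in Three Variables*, Ann. of Math. Stud. 123 (1990), §12.5 p. 182
  (`Φ(γ, f)`), §12.6 p. 187 («if `π` is supercuspidal, `f_π` may be taken to be a matrix coefficient»), §4.9 pp. 54–56.
-/

set_option autoImplicit false

noncomputable section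

open MeasureTheory Measure Set Filter Topology NumberField IsDedekindDomain
open scoped ENNReal NNReal Matrix MatrixGroups

namespace Literature.NumberTheory.Rogawski1990

open Literature.NumberTheory.Automorphic Literature.NumberTheory.Automorphic.UnitaryGroup

set_option maxHeartbeats 1600000 in
set_option synthInstance.maxHeartbeats 400000 in
-- instance-term unification on the CM local carriers (as in ★ `classOrbitalIntegral_eq_smul_integral_prod_of_torus_regular` ∕ ★ p852804)
/-- **ORBITAL INTEGRALS OF SUPERCUSPIDAL MATRIX COEFFICIENTS OF `U(Φ₃)(L⁺_v)` VANISH AT THE REGULAR HYPERBOLIC CLASSES** (Selberg principle for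
supercuspidal coefficients; the `regG ∖ ellG` clause of a pseudo-coefficient, [Rogawski1990, §12.6 p. 187]).  Non-split `v` (`hns`); `ν_G` any Haar measure on
`G = (cmDatum L 3 Φ₃).Local v` (`= Gqs L v`), `mG` a CANONICAL orbital family for `(IsRegularElt, ν_G)`; the centre of `G` compact (`hZ`, ★ `isCompact_center_Gqs`);
`r` an irreducible smooth representation of `G` whose class is SUPERCUSPIDAL, `ψ ∈ Ṽ` (`hψ`), `y ∈ V`; `t = diag(d)` in the diagonal torus with unit differences
`dᵢ − dⱼ` (`hreg`; = `IsRegularElt t`, ★ `isUnit_sub_of_isRegularElt_glDiagonal`) and `γ` conjugate to `t` (`hγ`; i.e. `γ ∈ hyperbolicSet L v`).  Then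
`classOrbitalIntegral mG (fun g => ψ (r.ρ g y)) ⟦γ⟧ = 0`. [cite: HarishChandra1970, Part VIII §1 Lemma 45 (pp. 92–93); Part I §3 p. 9]
[cite: Rogawski1990, §12.6 p. 187; §12.5 p. 182; §4.9 pp. 54–56] -/
theorem classOrbitalIntegral_matrixCoeff_eq_zero_of_isSupercuspidal
    (L : Type) [Field L] [NumberField L] [IsCMField L]
    {v : HeightOneSpectrum (𝓞 ↥(maximalRealSubfield L))} (hns : ∀ w : PlacesOver L v, IsCMField.complexConj L • w.1 = w.1)
    [MeasurableSpace ((cmDatum L 3 (Matrix.of fun i j : Fin 3 => if i.val + j.val + 1 = 3 then (1 : L) else 0)).Local v)] [BorelSpace ((cmDatum L 3 (Matrix.of fun i j : Fin 3 => if i.val + j.val + 1 = 3 then (1 : L) else 0)).Local v)]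
    [∀ γ : (cmDatum L 3 (Matrix.of fun i j : Fin 3 => if i.val + j.val + 1 = 3 then (1 : L) else 0)).Local v, MeasurableSpace (((cmDatum L 3 (Matrix.of fun i j : Fin 3 => if i.val + j.val + 1 = 3 then (1 : L) else 0)).Local v) ⧸ Subgroup.centralizer ({γ} : Set ((cmDatum L 3 (Matrix.of fun i j : Fin 3 => if i.val + j.val + 1 = 3 then (1 : L) else 0)).Local v)))]
    [∀ γ : (cmDatum L 3 (Matrix.of fun i j : Fin 3 => if i.val + j.val + 1 = 3 then (1 : L) else 0)).Local v, BorelSpace (((cmDatum L 3 (Matrix.of fun i j : Fin 3 => if i.val + j.val + 1 = 3 then (1 : L) else 0)).Local v) ⧸ Subgroup.centralizer ({γ} : Set ((cmDatum L 3 (Matrix.of fun i j : Fin 3 => if i.val + j.val + 1 = 3 then (1 : L) else 0)).Local v)))]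
    (νG : Measure ((cmDatum L 3 (Matrix.of fun i j : Fin 3 => if i.val + j.val + 1 = 3 then (1 : L) else 0)).Local v)) [νG.IsHaarMeasure] [νG.IsMulRightInvariant]
    {mG : OrbitalMeasureFamily ((cmDatum L 3 (Matrix.of fun i j : Fin 3 => if i.val + j.val + 1 = 3 then (1 : L) else 0)).Local v)}
    (hmG : mG.IsCanonical (fun γ => IsRegularElt (γ.val : GL (Fin 3) (LocalRing L v))) νG)
    (hZ : IsCompact ((Subgroup.center ((cmDatum L 3 (Matrix.of fun i j : Fin 3 => if i.val + j.val + 1 = 3 then (1 : L) else 0)).Local v) : Subgroup ((cmDatum L 3 (Matrix.of fun i j : Fin 3 => if i.val + j.val + 1 = 3 then (1 : L) else 0)).Local v)) : Set ((cmDatum L 3 (Matrix.of fun i j : Fin 3 => if i.val + j.val + 1 = 3 then (1 : L) else 0)).Local v)))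
    (r : SmoothIrrep ((cmDatum L 3 (Matrix.of fun i j : Fin 3 => if i.val + j.val + 1 = 3 then (1 : L) else 0)).Local v)) (hr : (IrrClass.mk r).IsSupercuspidal)
    (ψ : Module.Dual ℂ r.V) (hψ : ψ ∈ r.ρ.contragredient) (y : r.V)
    (t : ↥(torusU (conjLocal L (IsCMField.complexConj L) v) (cmLocalForm L 3 v))) {d : Fin 3 → (LocalRing L v)ˣ}
    (hd : glDiagonal 3 (LocalRing L v) d = ((t : ↥(unitaryGroupOfForm (conjLocal L (IsCMField.complexConj L) v) (cmLocalForm L 3 v))) : GL (Fin 3) (LocalRing L v)))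
    (hreg : ∀ i j, i ≠ j → IsUnit ((d i : LocalRing L v) - d j))
    {γ : (cmDatum L 3 (Matrix.of fun i j : Fin 3 => if i.val + j.val + 1 = 3 then (1 : L) else 0)).Local v} (hγ : IsConj ((t : ↥(unitaryGroupOfForm (conjLocal L (IsCMField.complexConj L) v) (cmLocalForm L 3 v))) : (cmDatum L 3 (Matrix.of fun i j : Fin 3 => if i.val + j.val + 1 = 3 then (1 : L) else 0)).Local v) γ) :
    classOrbitalIntegral mG (fun g : (cmDatum L 3 (Matrix.of fun i j : Fin 3 => if i.val + j.val + 1 = 3 then (1 : L) else 0)).Local v => ψ (r.ρ g y)) (ConjClasses.mk γ) = 0 := by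
  letI := r.instAddCommGroup
  letI := r.instModule
  obtain ⟨w⟩ := PlacesOver.nonempty L v
  have hw : IsCMField.complexConj L • w.1 = w.1 := hns w
  -- the identity frame `e₁ = cmDatumLocalCongr L v 1 _ h1`, `e₁ u = u`
  have h1 : formCongr (conjLocal L (IsCMField.complexConj L) v) (1 : GL (Fin 3) (LocalRing L v))
      (((Matrix.of fun i j : Fin 3 => if i.val + j.val + 1 = 3 then (1 : L) else 0)).map (algebraMap L (LocalRing L v))) = (1 : LocalRing L v) • ((Matrix.of fun i j : Fin 3 => if i.val + j.val + 1 = 3 then (1 : L) else 0)).map (algebraMap L (LocalRing L v)) := by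
    rw [formCongr_one_eq, one_smul]
  have he : ∀ u : ↥(unitaryGroupOfForm (conjLocal L (IsCMField.complexConj L) v) (cmLocalForm L 3 v)), cmDatumLocalCongr L v (1 : GL (Fin 3) (LocalRing L v)) isUnit_one h1 u = u := fun u => by
    apply Subtype.ext
    apply Units.ext
    change ((1 : GL (Fin 3) (LocalRing L v)) * (u : GL (Fin 3) (LocalRing L v)) * (1 : GL (Fin 3) (LocalRing L v))⁻¹).val =
      (u : GL (Fin 3) (LocalRing L v)).val
    rw [inv_one, mul_one, one_mul]
  -- the twist units `d₀⁻¹dⱼ − 1 = d₀⁻¹ (dⱼ − d₀)`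
  have hab : ∀ j : Fin 3, j ≠ 0 → IsUnit ((((d 0)⁻¹ * d j : (LocalRing L v)ˣ) : LocalRing L v) - 1) := fun j hj => by
    have e1 : (((d 0)⁻¹ * d j : (LocalRing L v)ˣ) : LocalRing L v) - 1 =
        (((d 0)⁻¹ : (LocalRing L v)ˣ) : LocalRing L v) * ((d j : LocalRing L v) - d 0) := by
      rw [Units.val_mul, mul_sub, Units.inv_mul]
    rw [e1]
    exact ((d 0)⁻¹).isUnit.mul (hreg j 0 hj)
  -- Borel structures on the `unitaryGroupOfForm` spelling (for `K₃`, `κ`, `μ_N`; the `G`-side ones are the binders)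
  letI mU : MeasurableSpace ↥(unitaryGroupOfForm (conjLocal L (IsCMField.complexConj L) v) (cmLocalForm L 3 v)) := borel ↥(unitaryGroupOfForm (conjLocal L (IsCMField.complexConj L) v) (cmLocalForm L 3 v))
  haveI : BorelSpace ↥(unitaryGroupOfForm (conjLocal L (IsCMField.complexConj L) v) (cmLocalForm L 3 v)) := ⟨rfl⟩
  haveI : LocallyCompactSpace ↥(unitaryGroupOfForm (conjLocal L (IsCMField.complexConj L) v) (cmLocalForm L 3 v)) := locallyCompactSpace_local (IsCMField.complexConj L) 3 _ v
  haveI : SecondCountableTopology ↥(unitaryGroupOfForm (conjLocal L (IsCMField.complexConj L) v) (cmLocalForm L 3 v)) := secondCountableTopology_local (IsCMField.complexConj L) 3 _ v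
  haveI : LocallyCompactSpace ↥(unipotentU (conjLocal L (IsCMField.complexConj L) v) (cmLocalForm L 3 v)) := (isClosed_cmBorelTriple_N L v).isClosedEmbedding_subtypeVal.locallyCompactSpace
  haveI : SecondCountableTopology ↥(unipotentU (conjLocal L (IsCMField.complexConj L) v) (cmLocalForm L 3 v)) := TopologicalSpace.Subtype.secondCountableTopology _
  haveI : SecondCountableTopology (LocalRing L v) := secondCountableTopology_localRing (E := L) v
  letI : Invertible (2 : LocalRing L v) := (isUnit_two_localRing L v).invertible
  haveI hR : (Measure.haar : Measure ↥(unipotentU (conjLocal L (IsCMField.complexConj L) v) (cmLocalForm L 3 v))).IsMulRightInvariant :=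
    HeisRing.isMulRightInvariant_of_isHaarMeasure_unipotentU (conjLocal L (IsCMField.complexConj L) v) (conjLocal_conjLocal_cm L v)
      (continuous_conjLocal L (IsCMField.complexConj L) v) (cmLocalForm_eq_over L 3 v) Measure.haar
  -- the coefficient: continuous, compactly supported, a cusp form
  have hsc : r.ρ.IsSupercuspidal := (IrrClass.isSupercuspidal_mk r).1 hr
  have h0c : Continuous (fun g : (cmDatum L 3 (Matrix.of fun i j : Fin 3 => if i.val + j.val + 1 = 3 then (1 : L) else 0)).Local v => ψ (r.ρ g y)) := r.ρ.continuous_matrixCoeff ψ (r.isSmooth y)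
  have h0s : HasCompactSupport (fun g : (cmDatum L 3 (Matrix.of fun i j : Fin 3 => if i.val + j.val + 1 = 3 then (1 : L) else 0)).Local v => ψ (r.ρ g y)) := hsc.hasCompactSupport_matrixCoeff hZ hψ y
  have hcusp : ∀ a b : ↥(unitaryGroupOfForm (conjLocal L (IsCMField.complexConj L) v) (cmLocalForm L 3 v)), Integrable (fun n : ↥(unipotentU (conjLocal L (IsCMField.complexConj L) v) (cmLocalForm L 3 v)) => ψ (r.ρ (a * (n : ↥(unitaryGroupOfForm (conjLocal L (IsCMField.complexConj L) v) (cmLocalForm L 3 v))) * b) y)) (Measure.haar : Measure ↥(unipotentU (conjLocal L (IsCMField.complexConj L) v) (cmLocalForm L 3 v))) →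
      ∫ n : ↥(unipotentU (conjLocal L (IsCMField.complexConj L) v) (cmLocalForm L 3 v)), ψ (r.ρ (a * (n : ↥(unitaryGroupOfForm (conjLocal L (IsCMField.complexConj L) v) (cmLocalForm L 3 v))) * b) y) ∂(Measure.haar : Measure ↥(unipotentU (conjLocal L (IsCMField.complexConj L) v) (cmLocalForm L 3 v))) = 0 :=
    fun a b hi => integral_dual_apply_cmBorelTriple_N_eq_zero_of_isSupercuspidal L v hns r hr Measure.haar ψ y a b hi
  -- the class `⟦γ⟧ = ⟦t⟧ = ⟦e₁ t⟧`, and the Selberg principle in the identity frame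
  have hcl : ConjClasses.mk ((t : ↥(unitaryGroupOfForm (conjLocal L (IsCMField.complexConj L) v) (cmLocalForm L 3 v))) : (cmDatum L 3 (Matrix.of fun i j : Fin 3 => if i.val + j.val + 1 = 3 then (1 : L) else 0)).Local v) = ConjClasses.mk γ := ConjClasses.mk_eq_mk_iff_isConj.mpr hγ
  have key := classOrbitalIntegral_torus_eq_zero_of_cuspidal' L ((Matrix.of fun i j : Fin 3 => if i.val + j.val + 1 = 3 then (1 : L) else 0)) (antidiagOne_isHermitian L 3) (isUnit_antidiagOne_det L 3) w hw
    (1 : GL (Fin 3) (LocalRing L v)) isUnit_one h1 νG hmG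
    (K := cmLocalIntegralLevel L 3 ((Matrix.of fun i j : Fin 3 => if i.val + j.val + 1 = 3 then (1 : L) else 0)) v) (fun _ => Iff.rfl) (Measure.haar : Measure ↥(unipotentU (conjLocal L (IsCMField.complexConj L) v) (cmLocalForm L 3 v))) t hd hreg (hab 1 (by decide)) (hab 2 (by decide))
    (φ := fun g : (cmDatum L 3 (Matrix.of fun i j : Fin 3 => if i.val + j.val + 1 = 3 then (1 : L) else 0)).Local v => ψ (r.ρ g y)) (φ₀ := fun g : (cmDatum L 3 (Matrix.of fun i j : Fin 3 => if i.val + j.val + 1 = 3 then (1 : L) else 0)).Local v => ψ (r.ρ g y)) (fun u => congrArg (fun g : (cmDatum L 3 (Matrix.of fun i j : Fin 3 => if i.val + j.val + 1 = 3 then (1 : L) else 0)).Local v => ψ (r.ρ g y)) (he u)) h0c h0s hcusp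
  rw [he] at key
  exact hcl ▸ key

/-! ## ED. 2 (append-only) — the pseudo-coefficient shape `c · conj ψ(r(·) y)` -/

set_option maxHeartbeats 1600000 in
set_option synthInstance.maxHeartbeats 400000 in
-- instance-term unification on the CM local carriers (as in ★ `classOrbitalIntegral_eq_smul_integral_prod_of_torus_regular` ∕ ★ p852804)
/-- **The same for the PSEUDO-COEFFICIENT SHAPE `g ↦ c · conj ψ(r(g) y)`** (ED. 2): for `v` non-split, `r` irreducible smooth on
`G = (cmDatum L 3 Φ₃).Local v` with supercuspidal class, `ψ ∈ Ṽ`, `y ∈ V`, `c ∈ ℂ`, a canonical family `mG`, compact centre, and `γ` conjugate to a diagonal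
`t = diag(d)` with unit differences: `classOrbitalIntegral mG (fun g => c * conj (ψ (r.ρ g y))) ⟦γ⟧ = 0` — the `regG ∖ ellG` clause of
`IsPseudoCoeff` for `f_π = d(π)(B v v)⁻¹ · conj⟨v, π(·)v⟩ = d(π)(B v v)⁻¹ · B (π(·) v) v` read with `ψ := B v` ([Rogawski1990, §12.6 p. 187]: «if `π` is
supercuspidal, `f_π` may be taken to be a matrix coefficient»).  Proof: ★ `classOrbitalIntegral_torus_eq_zero_of_cuspidal_coeff` (FILE 1, S4) in the identity
frame, inputs as in `classOrbitalIntegral_matrixCoeff_eq_zero_of_isSupercuspidal`.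
[cite: Rogawski1990, §12.6 p. 187; §12.5 p. 182] [cite: HarishChandra1970, Part VIII §1 Lemma 45 (pp. 92–93); Part I §3 p. 9] -/
theorem classOrbitalIntegral_smul_conj_matrixCoeff_eq_zero_of_isSupercuspidal
    (L : Type) [Field L] [NumberField L] [IsCMField L]
    {v : HeightOneSpectrum (𝓞 ↥(maximalRealSubfield L))} (hns : ∀ w : PlacesOver L v, IsCMField.complexConj L • w.1 = w.1)
    [MeasurableSpace ((cmDatum L 3 (Matrix.of fun i j : Fin 3 => if i.val + j.val + 1 = 3 then (1 : L) else 0)).Local v)] [BorelSpace ((cmDatum L 3 (Matrix.of fun i j : Fin 3 => if i.val + j.val + 1 = 3 then (1 : L) else 0)).Local v)]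
    [∀ γ : (cmDatum L 3 (Matrix.of fun i j : Fin 3 => if i.val + j.val + 1 = 3 then (1 : L) else 0)).Local v, MeasurableSpace (((cmDatum L 3 (Matrix.of fun i j : Fin 3 => if i.val + j.val + 1 = 3 then (1 : L) else 0)).Local v) ⧸ Subgroup.centralizer ({γ} : Set ((cmDatum L 3 (Matrix.of fun i j : Fin 3 => if i.val + j.val + 1 = 3 then (1 : L) else 0)).Local v)))]
    [∀ γ : (cmDatum L 3 (Matrix.of fun i j : Fin 3 => if i.val + j.val + 1 = 3 then (1 : L) else 0)).Local v, BorelSpace (((cmDatum L 3 (Matrix.of fun i j : Fin 3 => if i.val + j.val + 1 = 3 then (1 : L) else 0)).Local v) ⧸ Subgroup.centralizer ({γ} : Set ((cmDatum L 3 (Matrix.of fun i j : Fin 3 => if i.val + j.val + 1 = 3 then (1 : L) else 0)).Local v)))]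
    (νG : Measure ((cmDatum L 3 (Matrix.of fun i j : Fin 3 => if i.val + j.val + 1 = 3 then (1 : L) else 0)).Local v)) [νG.IsHaarMeasure] [νG.IsMulRightInvariant]
    {mG : OrbitalMeasureFamily ((cmDatum L 3 (Matrix.of fun i j : Fin 3 => if i.val + j.val + 1 = 3 then (1 : L) else 0)).Local v)}
    (hmG : mG.IsCanonical (fun γ => IsRegularElt (γ.val : GL (Fin 3) (LocalRing L v))) νG)
    (hZ : IsCompact ((Subgroup.center ((cmDatum L 3 (Matrix.of fun i j : Fin 3 => if i.val + j.val + 1 = 3 then (1 : L) else 0)).Local v) : Subgroup ((cmDatum L 3 (Matrix.of fun i j : Fin 3 => if i.val + j.val + 1 = 3 then (1 : L) else 0)).Local v)) : Set ((cmDatum L 3 (Matrix.of fun i j : Fin 3 => if i.val + j.val + 1 = 3 then (1 : L) else 0)).Local v)))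
    (r : SmoothIrrep ((cmDatum L 3 (Matrix.of fun i j : Fin 3 => if i.val + j.val + 1 = 3 then (1 : L) else 0)).Local v)) (hr : (IrrClass.mk r).IsSupercuspidal)
    (ψ : Module.Dual ℂ r.V) (hψ : ψ ∈ r.ρ.contragredient) (y : r.V) (c : ℂ)
    (t : ↥(torusU (conjLocal L (IsCMField.complexConj L) v) (cmLocalForm L 3 v))) {d : Fin 3 → (LocalRing L v)ˣ}
    (hd : glDiagonal 3 (LocalRing L v) d = ((t : ↥(unitaryGroupOfForm (conjLocal L (IsCMField.complexConj L) v) (cmLocalForm L 3 v))) : GL (Fin 3) (LocalRing L v)))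
    (hreg : ∀ i j, i ≠ j → IsUnit ((d i : LocalRing L v) - d j))
    {γ : (cmDatum L 3 (Matrix.of fun i j : Fin 3 => if i.val + j.val + 1 = 3 then (1 : L) else 0)).Local v} (hγ : IsConj ((t : ↥(unitaryGroupOfForm (conjLocal L (IsCMField.complexConj L) v) (cmLocalForm L 3 v))) : (cmDatum L 3 (Matrix.of fun i j : Fin 3 => if i.val + j.val + 1 = 3 then (1 : L) else 0)).Local v) γ) :
    classOrbitalIntegral mG (fun g : (cmDatum L 3 (Matrix.of fun i j : Fin 3 => if i.val + j.val + 1 = 3 then (1 : L) else 0)).Local v => c * starRingEnd ℂ (ψ (r.ρ g y))) (ConjClasses.mk γ) = 0 := by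
  letI := r.instAddCommGroup
  letI := r.instModule
  obtain ⟨w⟩ := PlacesOver.nonempty L v
  have hw : IsCMField.complexConj L • w.1 = w.1 := hns w
  -- the identity frame `e₁ = cmDatumLocalCongr L v 1 _ h1`, `e₁ u = u`
  have h1 : formCongr (conjLocal L (IsCMField.complexConj L) v) (1 : GL (Fin 3) (LocalRing L v))
      (((Matrix.of fun i j : Fin 3 => if i.val + j.val + 1 = 3 then (1 : L) else 0)).map (algebraMap L (LocalRing L v))) = (1 : LocalRing L v) • ((Matrix.of fun i j : Fin 3 => if i.val + j.val + 1 = 3 then (1 : L) else 0)).map (algebraMap L (LocalRing L v)) := by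
    rw [formCongr_one_eq, one_smul]
  have he : ∀ u : ↥(unitaryGroupOfForm (conjLocal L (IsCMField.complexConj L) v) (cmLocalForm L 3 v)), cmDatumLocalCongr L v (1 : GL (Fin 3) (LocalRing L v)) isUnit_one h1 u = u := fun u => by
    apply Subtype.ext
    apply Units.ext
    change ((1 : GL (Fin 3) (LocalRing L v)) * (u : GL (Fin 3) (LocalRing L v)) * (1 : GL (Fin 3) (LocalRing L v))⁻¹).val =
      (u : GL (Fin 3) (LocalRing L v)).val
    rw [inv_one, mul_one, one_mul]
  -- the twist units `d₀⁻¹dⱼ − 1 = d₀⁻¹ (dⱼ − d₀)`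
  have hab : ∀ j : Fin 3, j ≠ 0 → IsUnit ((((d 0)⁻¹ * d j : (LocalRing L v)ˣ) : LocalRing L v) - 1) := fun j hj => by
    have e1 : (((d 0)⁻¹ * d j : (LocalRing L v)ˣ) : LocalRing L v) - 1 =
        (((d 0)⁻¹ : (LocalRing L v)ˣ) : LocalRing L v) * ((d j : LocalRing L v) - d 0) := by
      rw [Units.val_mul, mul_sub, Units.inv_mul]
    rw [e1]
    exact ((d 0)⁻¹).isUnit.mul (hreg j 0 hj)
  -- Borel structures on the `unitaryGroupOfForm` spelling (for `K₃`, `κ`, `μ_N`; the `G`-side ones are the binders)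
  letI mU : MeasurableSpace ↥(unitaryGroupOfForm (conjLocal L (IsCMField.complexConj L) v) (cmLocalForm L 3 v)) := borel ↥(unitaryGroupOfForm (conjLocal L (IsCMField.complexConj L) v) (cmLocalForm L 3 v))
  haveI : BorelSpace ↥(unitaryGroupOfForm (conjLocal L (IsCMField.complexConj L) v) (cmLocalForm L 3 v)) := ⟨rfl⟩
  haveI : LocallyCompactSpace ↥(unitaryGroupOfForm (conjLocal L (IsCMField.complexConj L) v) (cmLocalForm L 3 v)) := locallyCompactSpace_local (IsCMField.complexConj L) 3 _ v
  haveI : SecondCountableTopology ↥(unitaryGroupOfForm (conjLocal L (IsCMField.complexConj L) v) (cmLocalForm L 3 v)) := secondCountableTopology_local (IsCMField.complexConj L) 3 _ v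
  haveI : LocallyCompactSpace ↥(unipotentU (conjLocal L (IsCMField.complexConj L) v) (cmLocalForm L 3 v)) := (isClosed_cmBorelTriple_N L v).isClosedEmbedding_subtypeVal.locallyCompactSpace
  haveI : SecondCountableTopology ↥(unipotentU (conjLocal L (IsCMField.complexConj L) v) (cmLocalForm L 3 v)) := TopologicalSpace.Subtype.secondCountableTopology _
  haveI : SecondCountableTopology (LocalRing L v) := secondCountableTopology_localRing (E := L) v
  letI : Invertible (2 : LocalRing L v) := (isUnit_two_localRing L v).invertible
  haveI hR : (Measure.haar : Measure ↥(unipotentU (conjLocal L (IsCMField.complexConj L) v) (cmLocalForm L 3 v))).IsMulRightInvariant :=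
    HeisRing.isMulRightInvariant_of_isHaarMeasure_unipotentU (conjLocal L (IsCMField.complexConj L) v) (conjLocal_conjLocal_cm L v)
      (continuous_conjLocal L (IsCMField.complexConj L) v) (cmLocalForm_eq_over L 3 v) Measure.haar
  -- the coefficient: continuous, compactly supported, a cusp form
  have hsc : r.ρ.IsSupercuspidal := (IrrClass.isSupercuspidal_mk r).1 hr
  have h0c : Continuous (fun g : (cmDatum L 3 (Matrix.of fun i j : Fin 3 => if i.val + j.val + 1 = 3 then (1 : L) else 0)).Local v => ψ (r.ρ g y)) := r.ρ.continuous_matrixCoeff ψ (r.isSmooth y)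
  have h0s : HasCompactSupport (fun g : (cmDatum L 3 (Matrix.of fun i j : Fin 3 => if i.val + j.val + 1 = 3 then (1 : L) else 0)).Local v => ψ (r.ρ g y)) := hsc.hasCompactSupport_matrixCoeff hZ hψ y
  have hcusp : ∀ a b : ↥(unitaryGroupOfForm (conjLocal L (IsCMField.complexConj L) v) (cmLocalForm L 3 v)), Integrable (fun n : ↥(unipotentU (conjLocal L (IsCMField.complexConj L) v) (cmLocalForm L 3 v)) => ψ (r.ρ (a * (n : ↥(unitaryGroupOfForm (conjLocal L (IsCMField.complexConj L) v) (cmLocalForm L 3 v))) * b) y)) (Measure.haar : Measure ↥(unipotentU (conjLocal L (IsCMField.complexConj L) v) (cmLocalForm L 3 v))) →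
      ∫ n : ↥(unipotentU (conjLocal L (IsCMField.complexConj L) v) (cmLocalForm L 3 v)), ψ (r.ρ (a * (n : ↥(unitaryGroupOfForm (conjLocal L (IsCMField.complexConj L) v) (cmLocalForm L 3 v))) * b) y) ∂(Measure.haar : Measure ↥(unipotentU (conjLocal L (IsCMField.complexConj L) v) (cmLocalForm L 3 v))) = 0 :=
    fun a b hi => integral_dual_apply_cmBorelTriple_N_eq_zero_of_isSupercuspidal L v hns r hr Measure.haar ψ y a b hi
  -- the class `⟦γ⟧ = ⟦t⟧ = ⟦e₁ t⟧`, and FILE 1 (S4) in the identity frame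
  have hcl : ConjClasses.mk ((t : ↥(unitaryGroupOfForm (conjLocal L (IsCMField.complexConj L) v) (cmLocalForm L 3 v))) : (cmDatum L 3 (Matrix.of fun i j : Fin 3 => if i.val + j.val + 1 = 3 then (1 : L) else 0)).Local v) = ConjClasses.mk γ := ConjClasses.mk_eq_mk_iff_isConj.mpr hγ
  have key := classOrbitalIntegral_torus_eq_zero_of_cuspidal_coeff L ((Matrix.of fun i j : Fin 3 => if i.val + j.val + 1 = 3 then (1 : L) else 0)) (antidiagOne_isHermitian L 3) (isUnit_antidiagOne_det L 3) w hw
    (1 : GL (Fin 3) (LocalRing L v)) isUnit_one h1 νG hmG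
    (K := cmLocalIntegralLevel L 3 ((Matrix.of fun i j : Fin 3 => if i.val + j.val + 1 = 3 then (1 : L) else 0)) v) (fun _ => Iff.rfl) (Measure.haar : Measure ↥(unipotentU (conjLocal L (IsCMField.complexConj L) v) (cmLocalForm L 3 v))) t hd hreg (hab 1 (by decide)) (hab 2 (by decide))
    r.ρ ψ y c h0c h0s hcusp (φ := fun g : (cmDatum L 3 (Matrix.of fun i j : Fin 3 => if i.val + j.val + 1 = 3 then (1 : L) else 0)).Local v => c * starRingEnd ℂ (ψ (r.ρ g y)))
    (fun u => congrArg (fun g : (cmDatum L 3 (Matrix.of fun i j : Fin 3 => if i.val + j.val + 1 = 3 then (1 : L) else 0)).Local v => c * starRingEnd ℂ (ψ (r.ρ g y))) (he u))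
  rw [he] at key
  exact hcl ▸ key

end Literature.NumberTheory.Rogawski1990

end
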